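import Literature.Analysis.FunctionSpaces.TorusSymL2Synthesis
import Literature.Analysis.FunctionSpaces.TorusFourierSynthesis
import Literature.Analysis.FunctionSpaces.TorusLerayHelmholtzProofs
import Literature.Analysis.FunctionSpaces.TorusWeightedGalerkinCoefficients
import Literature.Analysis.FluidPDE.LinearizedNSTorus
import HarnessLib

/-!
# Stub `stub_forceDictionary` of the line `registered`
# (crux stmt-AnomalousDissipation-11414, `WindLine.WindyGalerkinSteadyZerothLaw`)

The **force dictionary** of the Baire-category birth of the heart.  The parameter space is the
closed subset `𝒜 ⊆ SymL2 (Fin 3)` of conjugation-symmetric square-summable coefficient families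
`c : ℤ³ → ℂ³` with no mean mode (`c 0 = 0`) and transversal coefficients (`∑ⱼ kⱼ (c k)ⱼ = 0`);
the force of a parameter is the real field `F⟦c⟧ = SymL2.field (k ↦ e^{|k|²}) c : T³ → ℝ³`, whose
Fourier coefficients are `e^{-|k|²} c k`.  We prove that every such force is smooth, divergence
free and mean zero:

* the Gaussian weight `w k = e^{|k|²}` is a weight (`SymL2.IsWeight`: positive and even) with
  `∑ w(k)⁻² < ∞`, so the synthesis dictionary of `TorusSymL2Synthesis` applies:
  `𝓕(F⟦c⟧)(k) = coef w c k = e^{-|k|²} c k` (`SymL2.mFourierCoeff_field`);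
* `(1 + |k|²)^m e^{-|k|²} ≤ (m+3)! · e · (1 + |k|²)^{-3}` (from `xⁿ/n! ≤ eˣ` at `x = 1 + |k|²`)
  and `∑_{ℤ³} (1 + |k|²)^{-3} < ∞`; with `‖c k‖ ≤ ‖c‖` the family `coef w c` is rapidly decaying,
  hence `F⟦c⟧ = Re ∘ fourierSynth (coef w c)` is smooth (`RapidDecay.isSmooth_fourierSynth`,
  `IsSmooth.comp_clm`);
* transversality of `c k` passes to `e^{-|k|²} c k`, so `F⟦c⟧` is divergence free
  (`isDivFree_of_sum_mul_mFourierCoeff_eq_zero`), and `c 0 = 0` gives `𝓕(F⟦c⟧)(0) = 0`, so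
  `F⟦c⟧` has zero mean (`hasZeroMean_of_mFourierCoeff_zero`).
-/

noncomputable section

-- D-0017: single-problem summit ⇒ the duplicated namespace segment is by design.
set_option linter.dupNamespace false

open scoped InnerProductSpace Topology ComplexConjugate
open MeasureTheory Filter UnitAddTorus Set
open Literature.Analysis.FunctionSpaces Literature.Analysis.FunctionSpaces.Torus
open Literature.Analysis.FunctionSpaces.EuclideanSpace
open Literature.Analysis.FluidPDE Literature.Analysis.FluidPDE.Torus

namespace Summit.AnomalousDissipation.AnomalousDissipation.Theorems.WindLineWindyGalerkinSteadyZerothLaw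

/-- The flat three-torus (local notation). -/
local notation "𝕋³" => UnitAddTorus (Fin 3)
/-- Velocity values (local notation). -/
local notation "E³" => EuclideanSpace ℝ (Fin 3)
set_option quotPrecheck false in
/-- admissible parameters -/
local notation "𝒜" => ({c : SymL2 (Fin 3) | c 0 = 0 ∧
  ∀ k : Fin 3 → ℤ, ∑ j : Fin 3, ((k j : ℤ) : ℂ) * c k j = 0} : Set (SymL2 (Fin 3)))
/-- the force of a parameter -/
local notation "F⟦" c "⟧" => SymL2.field (fun k : Fin 3 → ℤ => Real.exp (freqNormSq k)) (c : SymL2 (Fin 3))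

/-! ## The Gaussian weight `k ↦ e^{|k|²}` -/

/-- The Gaussian weight `k ↦ e^{|k|²}` on `ℤ³` is a weight: positive and even. -/
theorem forceDict_isWeight : SymL2.IsWeight (fun k : Fin 3 → ℤ => Real.exp (freqNormSq k)) :=
  ⟨fun _ => Real.exp_pos _, fun k => by rw [freqNormSq_neg]⟩

/-- **Polynomial against Gaussian**: `(1 + |k|²)^m e^{-|k|²} ≤ (m+3)! · e · ((1 + |k|²)^3)⁻¹`
(from `Nⁿ/n! ≤ e^N` at `N = 1 + |k|²`, `n = m + 3`). -/
theorem forceDict_pow_mul_exp_inv_le (m : ℕ) (k : Fin 3 → ℤ) :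
    (1 + freqNormSq k) ^ m * (Real.exp (freqNormSq k))⁻¹ ≤
      ((m + 3).factorial * Real.exp 1) * ((1 + freqNormSq k) ^ 3)⁻¹ := by
  have hNpos : 0 < 1 + freqNormSq k := by linarith [freqNormSq_nonneg k]
  have hfac : (0 : ℝ) < (m + 3).factorial := Nat.cast_pos.2 (Nat.factorial_pos _)
  -- `N^(m+3) ≤ (m+3)! e^N = (m+3)! · e · e^{|k|²}`
  have key : (1 + freqNormSq k) ^ (m + 3) ≤
      (m + 3).factorial * (Real.exp 1 * Real.exp (freqNormSq k)) := by
    rw [← Real.exp_add]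
    have h := Real.pow_div_factorial_le_exp (1 + freqNormSq k) hNpos.le (m + 3)
    rw [div_le_iff₀ hfac] at h
    linarith
  rw [← div_eq_mul_inv, ← div_eq_mul_inv, div_le_div_iff₀ (Real.exp_pos _) (pow_pos hNpos 3),
    ← pow_add]
  calc (1 + freqNormSq k) ^ (m + 3)
      ≤ (m + 3).factorial * (Real.exp 1 * Real.exp (freqNormSq k)) := key
    _ = (m + 3).factorial * Real.exp 1 * Real.exp (freqNormSq k) := by ring

/-- `∑_{k ∈ ℤ³} (1 + |k|²)^m e^{-|k|²} < ∞` for every `m` (comparison with `∑ (1 + |k|²)^{-3}`). -/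
theorem forceDict_summable_pow_mul_exp_inv (m : ℕ) :
    Summable fun k : Fin 3 → ℤ => (1 + freqNormSq k) ^ m * (Real.exp (freqNormSq k))⁻¹ := by
  have hs : Summable fun k : Fin 3 → ℤ =>
      ((m + 3).factorial * Real.exp 1) * ((1 + freqNormSq k) ^ 3)⁻¹ := by
    have h := (summable_inv_one_add_freqNormSq_pow_card (d := Fin 3)).mul_left
      ((m + 3).factorial * Real.exp 1)
    simpa only [Fintype.card_fin] using h
  exact hs.of_nonneg_of_le
    (fun k => mul_nonneg (one_add_freqNormSq_pow_nonneg k m) (inv_nonneg.2 (Real.exp_pos _).le))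
    (forceDict_pow_mul_exp_inv_le m)

/-- `∑_{k ∈ ℤ³} (e^{|k|²})⁻² < ∞`: the Gaussian weight is admissible for the synthesis
dictionary of `TorusSymL2Synthesis`. -/
theorem forceDict_summable_inv_sq :
    Summable fun k : Fin 3 → ℤ => (Real.exp (freqNormSq k))⁻¹ ^ 2 := by
  refine (forceDict_summable_pow_mul_exp_inv 0).of_nonneg_of_le (fun k => sq_nonneg _) fun k => ?_
  rw [pow_zero, one_mul, sq]
  have h0 : 0 ≤ (Real.exp (freqNormSq k))⁻¹ := inv_nonneg.2 (Real.exp_pos _).le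
  have h1 : (Real.exp (freqNormSq k))⁻¹ ≤ 1 :=
    inv_le_one_of_one_le₀ (Real.one_le_exp (freqNormSq_nonneg k))
  exact mul_le_of_le_one_left h0 h1

/-! ## The coefficient family `e^{-|k|²} c k` -/

/-- **Rapid decay of the Gaussian-damped coefficients**: for `c ∈ SymL2 (Fin 3)` the family
`coef w c k = e^{-|k|²} c k` satisfies `∑ (1 + |k|²)^m ‖coef w c k‖ < ∞` for every `m`
(`‖c k‖ ≤ ‖c‖`). -/
theorem forceDict_rapidDecay (c : SymL2 (Fin 3)) :
    RapidDecay (SymL2.coef (fun k : Fin 3 → ℤ => Real.exp (freqNormSq k)) c) := by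
  intro m
  refine ((forceDict_summable_pow_mul_exp_inv m).mul_right ‖c‖).of_nonneg_of_le
    (fun k => mul_nonneg (one_add_freqNormSq_pow_nonneg k m) (norm_nonneg _)) fun k => ?_
  rw [SymL2.norm_coef forceDict_isWeight, mul_assoc]
  exact mul_le_mul_of_nonneg_left
    (mul_le_mul_of_nonneg_left (SymL2.norm_apply_le c k) (inv_nonneg.2 (Real.exp_pos _).le))
    (one_add_freqNormSq_pow_nonneg k m)

/-- **The force is smooth**: `F⟦c⟧ = Re ∘ fourierSynth (coef w c)` with rapidly decaying
coefficients. -/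
theorem forceDict_isSmooth (c : SymL2 (Fin 3)) : IsSmooth F⟦c⟧ := by
  have h : F⟦c⟧ = ⇑EuclideanSpace.realPart ∘
      fourierSynth (SymL2.coef (fun k : Fin 3 → ℤ => Real.exp (freqNormSq k)) c) := rfl
  rw [h]
  exact IsSmooth.comp_clm EuclideanSpace.realPart (forceDict_rapidDecay c).isSmooth_fourierSynth

/-- **The Fourier coefficients of the force**: `𝓕(F⟦c⟧)(k) = (e^{|k|²})⁻¹ • c k`. -/
theorem forceDict_mFourierCoeff (c : SymL2 (Fin 3)) (k : Fin 3 → ℤ) :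
    mFourierCoeff (EuclideanSpace.complexify ∘ F⟦c⟧) k = ((Real.exp (freqNormSq k) : ℂ))⁻¹ • c k :=
  SymL2.mFourierCoeff_field forceDict_isWeight forceDict_summable_inv_sq c k

/-! ## Main theorem -/

/-- **Registered stub `stub_forceDictionary` (the force dictionary).**  For every admissible
parameter `c ∈ 𝒜` — no mean mode, transversal coefficients — the force `F⟦c⟧` (Fourier
coefficients `e^{-|k|²} c k`) is smooth, divergence free and mean zero. -/
theorem stub_forceDictionary : ∀ c : 𝒜, IsSmooth F⟦c⟧ ∧ IsDivFree F⟦c⟧ ∧ HasZeroMean F⟦c⟧ := by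
  intro c
  have hc := c.2
  simp only [Set.mem_setOf_eq] at hc
  obtain ⟨h0, htr⟩ := hc
  have hsmooth : IsSmooth F⟦c⟧ := forceDict_isSmooth c
  refine ⟨hsmooth, ?_, ?_⟩
  · -- transversal coefficients ⇒ divergence free
    refine isDivFree_of_sum_mul_mFourierCoeff_eq_zero hsmooth fun k => ?_
    rw [forceDict_mFourierCoeff]
    simp only [PiLp.smul_apply, smul_eq_mul]
    calc ∑ j, (k j : ℂ) * (((Real.exp (freqNormSq k) : ℂ))⁻¹ * (c : SymL2 (Fin 3)) k j)
        = ((Real.exp (freqNormSq k) : ℂ))⁻¹ * ∑ j, (k j : ℂ) * (c : SymL2 (Fin 3)) k j := by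
          rw [Finset.mul_sum]
          exact Finset.sum_congr rfl fun j _ => by ring
      _ = 0 := by rw [htr k, mul_zero]
  · -- no mean mode ⇒ mean zero
    refine hasZeroMean_of_mFourierCoeff_zero ?_
    rw [forceDict_mFourierCoeff, h0, smul_zero]

end Summit.AnomalousDissipation.AnomalousDissipation.Theorems.WindLineWindyGalerkinSteadyZerothLaw
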